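import Summits.BirchSwinnertonDyer.BirchSwinnertonDyer.Theorems.ByReductionTypeAtTwoFineSelmerConjAAtTwoAdditivePotGoodNarrowRankCertificate63644LayerParity
import Summits.BirchSwinnertonDyer.BirchSwinnertonDyer.Theorems.ByReductionTypeAtTwoOrdKatoHalfAtTwoIsoConjATwoOfNarrowRankCertificate
import HarnessLib

/-!
# Route `ByReductionTypeAtTwo` (rung K4), crux C1″ `FineSelmerConjAAtTwoAdditivePotGood` (item stmt-BirchSwinnertonDyer-22615):
# THE CENSUS ROW `445508b1` (Δ_cubic > 0, cubic point field of discriminant `63644`, `2 = 𝔭₁²𝔭₂`) — statement (A)₂ UNCONDITIONALLY: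
# ZERO hypotheses, ZERO named facts (a `--supports 22615` file; seat `bsd-2adic-k4-w1` GEN 10; UPGRADES `conjA_two_445508b1_of_layerOneBit hLim2 … h1`
# (hLim2 + one displayed bit, LIM35@2-REAL-flagged))

HONEST FRAMING (cell `bsd-2adic`, D-0036/D-0054/D-0152): ONE kernel theorem about ONE curve (plus a generic re-statement of the narrow-Fukuda door
with the point field as a parameter); closes nothing at the `∀`-level (C1″ 22615 research-open); nothing booked; BSD for `445508b1` is NOT proved by
this (statement (A) is one input of the Kato half at `2`).

THE ROAD (the first `Δ > 0` census row whose cubic point field has TWO primes above `2`). The `2`-torsion point field of `445508b1` is the totally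
real cubic `E = ℚ(θ)`, `θ³ − θ² − 47θ + 95 = 0` (`d = 63644`, `h = 1` kernel, `2 = 𝔭₁²𝔭₂`, Fukuda index `0` kernel by the even-index certificate of
`…TwoLayerStampsEvenIndexD`). The NARROW-FUKUDA door of cruxlead-19573-w2 GEN 9 (`conjA_two_of_narrowRank_sqrtTwo_model_pointField`, p740352):
Fukuda index `0` + ONE equality `[Cl⁺(E(√2)) : Cl⁺(E(√2))²] = [Cl⁺(E) : Cl⁺(E)²]` ⟹ narrow `μ₂ = 0` and bounded narrow defect along `E_∞` ⟹ (A)₂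
(GEN 8 `NarrowMu` door). Both indices are `2`, KERNEL: `#(U⁺/U²)(E) = 2 = #(U⁺/U²)(E(√2))` by unit-signature certificates and `h(E)`, `h(E(√2))` odd
— the latter by genus theory with the dyadic non-norm unit `ε ≡ 3 (mod 𝔭₂³)` — (`…NarrowRankCertificate63644{Dyadic,Units,Layer,LayerUnits,LayerParity}`,
Literature `NarrowClassGroupTwoRankOddClassNumber`, `QuadraticExtensionOddClassNumberNonNormUnit`, `DyadicUnitNotNormFromSqrtTwo`, all this seat).
Matches the kit record of addL2x GEN 8 (`F3(i) n0=0 R`, `cyc6 = []`), now KERNEL. NO Lim 2017 fact, NO Ferrero–Washington, NO displayed bit.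

* `conjA_two_of_pointField_of_narrowRank_sqrtTwo_model` — the w2 door with the point field `ℚ̄^{Stab P} = E` as a PARAMETER (`subst`).
* `totallyRamifiedFrom_zero_adjoin_d63644` — Fukuda index `0` for every cyclotomic `ℤ₂`-extension of `ℚ(θ)` (even-index certificate, kernel).
* **`conjA_two_445508b1''`** — (A)₂ for `445508b1`, ZERO hypotheses.

References: [CoatesSujatha2005] Conj. A, Thm. 3.4; [Fukuda1994] Thm. 1 (2); [FrohlichTaylor1990] Ch. V §1; [Lang1990] Ch. 13 §4 Lemma 4.1.
-/

set_option autoImplicit false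
-- sibling precedent: the directory name repeats the summit name
set_option linter.dupNamespace false

noncomputable section

open scoped Classical IntermediateField NumberField

namespace Summit.BirchSwinnertonDyer.BirchSwinnertonDyer.Theorems.AddKatoTwo

open WeierstrassCurve Field Polynomial IsDedekindDomain NumberField Literature.NumberTheory.EllipticCurves
  Literature.NumberTheory.EllipticCurves.ZpExtension
  Literature.NumberTheory.GaloisRepresentations Literature.NumberTheory.IwasawaTheory Literature.NumberTheory.NumberFields
  Literature.Geometry.Kaehler.ComplexTorus
  Summit.BirchSwinnertonDyer.BirchSwinnertonDyer.Theorems.AlignedTransportAtTwoTorsionPointField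
  Summit.BirchSwinnertonDyer.BirchSwinnertonDyer.Theorems.SteinbergFibreAtTwo.NarrowRankCert

/-! ## §1 The narrow-Fukuda door with the point field as a parameter -/

/-- **The narrow-Fukuda door (w2 GEN 9) with the point field named**: `W/ℚ` elliptic, `P ∈ W[2] ∖ 0`, `ℚ̄^{Stab P} = E` of odd degree; Fukuda index
`0` for every cyclotomic `ℤ₂`-extension of `E`; a model `L ⊇ E` of `E(√2)` (`[L:E] = 2`, `s² = 2`) with `[Cl⁺(L) : Cl⁺(L)²] = [Cl⁺(E) : Cl⁺(E)²]`
⟹ (A) at `(W, 2)` for every cyclotomic `κ`. (`subst` + `conjA_two_of_narrowRank_sqrtTwo_model_pointField`.)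
[cite: Fukuda1994, Thm. 1 (2), p. 264] [cite: CoatesSujatha2005, Conj. A and Thm. 3.4] -/
theorem conjA_two_of_pointField_of_narrowRank_sqrtTwo_model (W : WeierstrassCurve ℚ) [W.IsElliptic] {P : geomTorsion W 2} (hP : P ≠ 0)
    (E : IntermediateField ℚ (AlgebraicClosure ℚ)) [FiniteDimensional ℚ E]
    (hF : IntermediateField.fixedField (MulAction.stabilizer (absoluteGaloisGroup ℚ) P) = E) (hodd : Odd (Module.finrank ℚ E))
    (h0 : ∀ κP : ZpExtension E 2, κP.IsCyclotomic → TotallyRamifiedFrom κP 0)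
    (L : Type) [Field L] [NumberField L] [Algebra E L] (hL : Module.finrank E L = 2) (s : L) (hs : s ^ 2 = 2)
    (hr : haveI : NumberField E := NumberField.mk
      (powMonoidHom (α := NarrowClassGroup L) 2).range.index = (powMonoidHom (α := NarrowClassGroup E) 2).range.index)
    (κ : ZpExtension ℚ 2) (hκ : κ.IsCyclotomic) :
    ∃ (γ : absoluteGaloisGroup ℚ) (D : W.FineSelmerDualData κ γ),
      Module.Finite ℤ_[2] (RestrictScalars ℤ_[2] (IwasawaAlgebra 2) D.X) := by
  subst hF
  haveI : NumberField ↥(IntermediateField.fixedField (MulAction.stabilizer (absoluteGaloisGroup ℚ) P)) := NumberField.mk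
  exact conjA_two_of_narrowRank_sqrtTwo_model_pointField W hP hodd h0 L hL s hs hr κ hκ

/-! ## §2 Fukuda's index `0` for `ℚ(θ)`, `θ³ − θ² − 47θ + 95 = 0` -/

variable {θ : AlgebraicClosure ℚ}

/-- **Fukuda's index is `0` for every cyclotomic `ℤ₂`-extension of `ℚ(θ)`, `θ³ − θ² − 47θ + 95 = 0`** (`2 = 𝔭₁²𝔭₂`): the EVEN-INDEX CERTIFICATE of
`…TwoLayerStampsEvenIndexD` (`u = [-2,-2,0]`, `v = [0,-1,-1]`, `m = [-404,-301,-57]`, `m' = [5152613, 2663747, 269054]` in the basis `1, θ', θ'²` of the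
index-`7` generator `θ' = (33 − 2θ − θ²)/2`, a root of `X³ − X² − 112X − 270`; `8 ∤ N(2 − m'³)`), fed to `totallyRamifiedFrom_zero_of_evenIndexCertificate`
(kernel, k4-w1 GEN 5). [cite: Fukuda1994, Thm. 1, p. 264] [cite: Washington1997, §13.1] -/
theorem totallyRamifiedFrom_zero_adjoin_d63644 (hθ : aeval θ (Cubic.toPoly ⟨1, ((-1 : ℤ) : ℚ), ((-47 : ℤ) : ℚ), ((95 : ℤ) : ℚ)⟩) = 0) :
    haveI : FiniteDimensional ℚ ↥ℚ⟮θ⟯ :=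
      IntermediateField.adjoin.finiteDimensional ⟨_, Cubic.monic_of_a_eq_one', by rwa [← aeval_def]⟩
    haveI : NumberField ↥ℚ⟮θ⟯ := NumberField.mk
    ∀ κP : ZpExtension ↥ℚ⟮θ⟯ 2, κP.IsCyclotomic → TotallyRamifiedFrom κP 0 := by
  haveI : FiniteDimensional ℚ ↥ℚ⟮θ⟯ :=
    IntermediateField.adjoin.finiteDimensional ⟨_, Cubic.monic_of_a_eq_one', by rwa [← aeval_def]⟩
  haveI : NumberField ↥ℚ⟮θ⟯ := NumberField.mk
  intro κP hκP
  have h3 : Module.finrank ℚ ↥ℚ⟮θ⟯ = 3 := finrank_adjoin_eq_three_of_irreducible irreducible_cubic_d63644p_min hθ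
  obtain ⟨b, -, hb⟩ := exists_ringOfIntegers_cubic_root (p := -1) (q := -47) (r := 95) hθ
  -- the index-7 generator `B = (33 − 2b − b²)/2`, a root of `X³ + (-1)X² + (-112)X + (-270)`
  obtain ⟨B, -, hB⟩ := exists_intElem_of_scaled_cubic ↥ℚ⟮θ⟯ b 33 (-2) (-1) (m := 2) (by norm_num) (-1) (-112) (-270)
    (by push_cast; linear_combination ((177 : 𝓞 ↥ℚ⟮θ⟯) + (31 : 𝓞 ↥ℚ⟮θ⟯) * b + (-7 : 𝓞 ↥ℚ⟮θ⟯) * b ^ 2 + (-1 : 𝓞 ↥ℚ⟮θ⟯) * b ^ 3) * hb)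
  have hB' : B ^ 3 + (-1 : ℤ) * B ^ 2 + (-112 : ℤ) * B + (-270 : ℤ) = 0 := by push_cast; linear_combination hB
  refine totallyRamifiedFrom_zero_of_evenIndexCertificate h3 κP hκP
    (((-2 : ℤ) : 𝓞 ↥ℚ⟮θ⟯) + ((-2 : ℤ) : 𝓞 ↥ℚ⟮θ⟯) * B + ((0 : ℤ) : 𝓞 ↥ℚ⟮θ⟯) * B ^ 2)
    (((0 : ℤ) : 𝓞 ↥ℚ⟮θ⟯) + ((-1 : ℤ) : 𝓞 ↥ℚ⟮θ⟯) * B + ((-1 : ℤ) : 𝓞 ↥ℚ⟮θ⟯) * B ^ 2)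
    (((-404 : ℤ) : 𝓞 ↥ℚ⟮θ⟯) + ((-301 : ℤ) : 𝓞 ↥ℚ⟮θ⟯) * B + ((-57 : ℤ) : 𝓞 ↥ℚ⟮θ⟯) * B ^ 2)
    (((5152613 : ℤ) : 𝓞 ↥ℚ⟮θ⟯) + ((2663747 : ℤ) : 𝓞 ↥ℚ⟮θ⟯) * B + ((269054 : ℤ) : 𝓞 ↥ℚ⟮θ⟯) * B ^ 2) ?_ ?_ ?_
  · push_cast; linear_combination (((-6 : ℤ) : 𝓞 ↥ℚ⟮θ⟯) + ((-2 : ℤ) : 𝓞 ↥ℚ⟮θ⟯) * B) * hB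
  · push_cast; linear_combination (((37563 : ℤ) : 𝓞 ↥ℚ⟮θ⟯) + ((3249 : ℤ) : 𝓞 ↥ℚ⟮θ⟯) * B) * hB
  · have hz : (2 : 𝓞 ↥ℚ⟮θ⟯) - (((5152613 : ℤ) : 𝓞 ↥ℚ⟮θ⟯) + ((2663747 : ℤ) : 𝓞 ↥ℚ⟮θ⟯) * B + ((269054 : ℤ) : 𝓞 ↥ℚ⟮θ⟯) * B ^ 2) ^ 3 =
        ((-33323579179492599784185 : ℤ) : 𝓞 ↥ℚ⟮θ⟯) + (-16577448121126689252653 : ℤ) * B + (-1493544940251771126546 : ℤ) * B ^ 2 := by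
      push_cast; linear_combination (((-122914001070771213977 : ℤ) : 𝓞 ↥ℚ⟮θ⟯) + ((-9625619191682651170 : ℤ) : 𝓞 ↥ℚ⟮θ⟯) * B + ((-597963208672360220 : ℤ) : 𝓞 ↥ℚ⟮θ⟯) * B ^ 2 + ((-19476833835369464 : ℤ) : 𝓞 ↥ℚ⟮θ⟯) * B ^ 3) * hB
    rw [hz]
    exact not_eight_dvd_norm_coords _ h3 B irreducible_cubic_d63644p hB' (-33323579179492599784185) (-16577448121126689252653) (-1493544940251771126546) (N := -31921748707874312141244519307757376674485156950)
      (by simp only [Matrix.one_fin_three, Matrix.det_fin_three, Matrix.add_apply, Matrix.smul_apply, sq, Matrix.mul_apply,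
        Fin.sum_univ_three, Matrix.of_apply, Matrix.cons_val', Matrix.cons_val_zero, Matrix.cons_val_one, Matrix.cons_val_two,
        Matrix.head_cons, Matrix.tail_cons, Matrix.empty_val', Matrix.cons_val_fin_one, smul_eq_mul]; norm_num) (by norm_num)

/-! ## §3 The row `445508b1` -/

set_option maxHeartbeats 800000 in
/-- **UNCONDITIONAL (A)₂ for the census curve `445508b1` — ZERO hypotheses, ZERO named facts.** Coates–Sujatha's statement (A) at `p = 2`: for every
cyclotomic `ℤ₂`-extension of `ℚ` the dual fine Selmer group of `[0, −1, 0, −14574772, −21411754440]` over `ℚ_∞` is finitely generated over `ℤ₂`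
(`∃ γ D` currency of C1″). KERNEL throughout: point field `ℚ(P) = ℚ(θ)`, `θ³ − θ² − 47θ + 95 = 0` (`d = 63644`, totally real, `h = 1`, `2 = 𝔭₁²𝔭₂`),
Fukuda index `0`, and the narrow rank certificate `[Cl⁺(ℚ(θ,√2)) : Cl⁺(ℚ(θ,√2))²] = 2 = [Cl⁺(ℚ(θ)) : Cl⁺(ℚ(θ))²]`; the narrow-Fukuda door does the rest.
UPGRADES `conjA_two_445508b1_of_layerOneBit hLim2`; BSD for `445508b1` is NOT proved by this. [cite: CoatesSujatha2005, Conj. A and Thm. 3.4]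
[cite: Fukuda1994, Thm. 1 (2), p. 264] [cite: FrohlichTaylor1990, Ch. V §1 (1.12)–(1.13)] -/
theorem conjA_two_445508b1'' (κ : ZpExtension ℚ 2) (hκ : κ.IsCyclotomic) :
    haveI := isElliptic_445508b1'
    ∃ (γ : absoluteGaloisGroup ℚ) (D : (⟨0, ((-1 : ℤ) : ℚ), 0, ((-14574772 : ℤ) : ℚ), ((-21411754440 : ℤ) : ℚ)⟩ : WeierstrassCurve ℚ).FineSelmerDualData κ γ),
      Module.Finite ℤ_[2] (RestrictScalars ℤ_[2] (IwasawaAlgebra 2) D.X) := by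
  haveI := isElliptic_445508b1'
  obtain ⟨β, hβ⟩ : ∃ β : AlgebraicClosure ℚ, aeval β (Cubic.toPoly ⟨1, ((-1 : ℤ) : ℚ), ((-14574772 : ℤ) : ℚ), ((-21411754440 : ℤ) : ℚ)⟩) = 0 :=
    IsAlgClosed.exists_aeval_eq_zero _ _ (by rw [Cubic.degree_of_a_ne_zero one_ne_zero]; norm_num)
  have hβ' : β ^ 3 + (-1 : AlgebraicClosure ℚ) * β ^ 2 + (-14574772 : AlgebraicClosure ℚ) * β + (-21411754440 : AlgebraicClosure ℚ) = 0 := by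
    have := hβ
    simp only [Cubic.toPoly, map_one, one_mul, aeval_add, aeval_mul, aeval_C, aeval_X_pow, aeval_X,
      eq_ratCast, Rat.cast_intCast] at this
    push_cast at this
    linear_combination this
  set θ : AlgebraicClosure ℚ := algebraMap ℚ (AlgebraicClosure ℚ) (72868465 / 343 : ℚ) +
      algebraMap ℚ (AlgebraicClosure ℚ) (33071 / 686 : ℚ) * β + algebraMap ℚ (AlgebraicClosure ℚ) (-15 / 686 : ℚ) * β ^ 2 with hθdef
  have hθ : aeval θ (Cubic.toPoly ⟨1, ((-1 : ℤ) : ℚ), ((-47 : ℤ) : ℚ), ((95 : ℤ) : ℚ)⟩) = 0 := by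
    simp only [Cubic.toPoly, map_one, one_mul, aeval_add, aeval_mul, aeval_C, aeval_X_pow, aeval_X, eq_ratCast,
      Rat.cast_intCast]
    rw [hθdef]
    simp only [eq_ratCast]
    push_cast
    linear_combination (((-36140533566601 : AlgebraicClosure ℚ) / 80707214) + ((-11359395 : AlgebraicClosure ℚ) / 322828856) * β + ((11159775 : AlgebraicClosure ℚ) / 161414428) * β ^ 2 + ((-3375 : AlgebraicClosure ℚ) / 322828856) * β ^ 3) * hβ'
  have hadj : IntermediateField.adjoin ℚ {θ} = IntermediateField.adjoin ℚ {β} := by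
    apply le_antisymm
    · rw [IntermediateField.adjoin_simple_le_iff, hθdef]
      have hβmem := IntermediateField.mem_adjoin_simple_self ℚ β
      exact add_mem (add_mem (_root_.algebraMap_mem _ _) (mul_mem (_root_.algebraMap_mem _ _) hβmem))
        (mul_mem (_root_.algebraMap_mem _ _) (pow_mem hβmem 2))
    · rw [IntermediateField.adjoin_simple_le_iff]
      have hβeq : β = algebraMap ℚ (AlgebraicClosure ℚ) (-3035 / 2 : ℚ) + algebraMap ℚ (AlgebraicClosure ℚ) (-434 : ℚ) * θ +
          algebraMap ℚ (AlgebraicClosure ℚ) (105 / 2 : ℚ) * θ ^ 2 := by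
        rw [hθdef]; simp only [eq_ratCast]; push_cast
        linear_combination (((14878575 : AlgebraicClosure ℚ) / 134456) + ((-3375 : AlgebraicClosure ℚ) / 134456) * β) * hβ'
      rw [hβeq]
      have hθmem := IntermediateField.mem_adjoin_simple_self ℚ θ
      exact add_mem (add_mem (_root_.algebraMap_mem _ _) (mul_mem (_root_.algebraMap_mem _ _) hθmem))
        (mul_mem (_root_.algebraMap_mem _ _) (pow_mem hθmem 2))
  obtain ⟨P₀, hP₀, hP₀eq⟩ := exists_geomTorsion_two_eq_some_root ((-1 : ℤ) : ℚ) ((-14574772 : ℤ) : ℚ) ((-21411754440 : ℤ) : ℚ) hβ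
  have hF : IntermediateField.fixedField (MulAction.stabilizer (absoluteGaloisGroup ℚ) P₀) =
      IntermediateField.adjoin ℚ {θ} := by
    rw [fixedField_stabilizer_eq_adjoin_root _ _ _ hβ hP₀eq, hadj]
    -- the two `Algebra ℚ ℚ̄` instance paths agree
    congr 1
  have hfm : (Cubic.toPoly ⟨1, ((-1 : ℤ) : ℚ), ((-47 : ℤ) : ℚ), ((95 : ℤ) : ℚ)⟩).Monic := Cubic.monic_of_a_eq_one'
  have hθint : IsIntegral ℚ θ := ⟨_, hfm, by rwa [← aeval_def]⟩
  haveI : FiniteDimensional ℚ ↥ℚ⟮θ⟯ := IntermediateField.adjoin.finiteDimensional hθint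
  haveI : FiniteDimensional ℚ ↥((CyclotomicZp.zpExtension 2).layer 1) := (CyclotomicZp.zpExtension 2).finiteDimensional_layer_holds 1
  haveI : NumberField ↥ℚ⟮θ⟯ := NumberField.mk
  haveI : NumberField ↥(ℚ⟮θ⟯ ⊔ (CyclotomicZp.zpExtension 2).layer 1) := NumberField.mk
  obtain ⟨-, hfinA, h3⟩ := layer_one_basics_d63644 hθ
  have hodd : Odd (Module.finrank ℚ ↥ℚ⟮θ⟯) := by rw [h3]; decide
  -- the model `A = ℚ(θ) ⊔ ℚ_1` of `ℚ(θ)(√2)`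
  obtain ⟨t, ht, ht2⟩ := CyclotomicZp.exists_mem_layer_one_sq_eq_two_zpExtension
  have hKA : ℚ⟮θ⟯ ≤ ℚ⟮θ⟯ ⊔ (CyclotomicZp.zpExtension 2).layer 1 := le_sup_left
  have htA : t ∈ ℚ⟮θ⟯ ⊔ (CyclotomicZp.zpExtension 2).layer 1 := (le_sup_right : (CyclotomicZp.zpExtension 2).layer 1 ≤ _) ht
  have ht'2 : (⟨t, htA⟩ : ↥(ℚ⟮θ⟯ ⊔ (CyclotomicZp.zpExtension 2).layer 1)) ^ 2 = 2 := by
    apply (algebraMap ↥(ℚ⟮θ⟯ ⊔ (CyclotomicZp.zpExtension 2).layer 1) (AlgebraicClosure ℚ)).injective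
    rw [map_pow, map_ofNat]
    exact ht2
  letI : Algebra ↥ℚ⟮θ⟯ ↥(ℚ⟮θ⟯ ⊔ (CyclotomicZp.zpExtension 2).layer 1) := (IntermediateField.inclusion hKA).toRingHom.toAlgebra
  haveI : IsScalarTower ℚ ↥ℚ⟮θ⟯ ↥(ℚ⟮θ⟯ ⊔ (CyclotomicZp.zpExtension 2).layer 1) := IsScalarTower.of_algebraMap_eq fun q => ((IntermediateField.inclusion hKA).commutes q).symm
  haveI : Module.Finite ↥ℚ⟮θ⟯ ↥(ℚ⟮θ⟯ ⊔ (CyclotomicZp.zpExtension 2).layer 1) := Module.Finite.of_restrictScalars_finite ℚ ↥ℚ⟮θ⟯ _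
  have hdeg : Module.finrank ↥ℚ⟮θ⟯ ↥(ℚ⟮θ⟯ ⊔ (CyclotomicZp.zpExtension 2).layer 1) = 2 := by
    have htower := Module.finrank_mul_finrank ℚ ↥ℚ⟮θ⟯ ↥(ℚ⟮θ⟯ ⊔ (CyclotomicZp.zpExtension 2).layer 1)
    rw [h3, hfinA] at htower
    omega
  have hr : (powMonoidHom (α := NarrowClassGroup ↥(ℚ⟮θ⟯ ⊔ (CyclotomicZp.zpExtension 2).layer 1)) 2).range.index = (powMonoidHom (α := NarrowClassGroup ↥ℚ⟮θ⟯) 2).range.index := by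
    rw [index_range_pow_two_narrowClassGroup_adjoin_sup_layer_one_d63644 hθ, index_range_pow_two_narrowClassGroup_adjoin_d63644 hθ]
  exact conjA_two_of_pointField_of_narrowRank_sqrtTwo_model _ hP₀ ℚ⟮θ⟯ hF hodd (totallyRamifiedFrom_zero_adjoin_d63644 hθ)
    ↥(ℚ⟮θ⟯ ⊔ (CyclotomicZp.zpExtension 2).layer 1) hdeg ⟨t, htA⟩ ht'2 hr κ hκ

end Summit.BirchSwinnertonDyer.BirchSwinnertonDyer.Theorems.AddKatoTwo

end
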